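import Mathlib
import Summits.ValiantsHypothesis.ValiantsHypothesis.Theorems.LacunarySymmetroidMatrixDescartesCensusDefs

/-!
# Tower graft line, stub S4a: a positive definite far letter is the identity after a congruence

By-name closer for the registered stub **S4a `stub_congruencePD : TowerGraftLawId → TowerGraftLawPD`** of the line
`Cruxes/WeakLifting/Lines/tower_graft.lean` (rev 4; crux `WeakLifting` = stmt-ValiantsHypothesis-19561, restricted
sub-case `TowerWeakLifting`; line planner val-idea-24 g0, critic of record val-idea-crit-6 g0, director R274 (4),
lead g27 R2682 (A)).

Content (support level, no tower / steepness hypothesis is used):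

* `exists_conj_eq_one` — over `ℝ` a positive definite `P` is CONGRUENT TO THE IDENTITY: `V * P * Vᵀ = 1` with
  `det V ≠ 0` (spectral theorem `IsHermitian.conjStarAlgAut_star_eigenvectorUnitary`: `Uᵀ P U = diag λ`, `λ > 0` by
  `PosDef.eigenvalues_pos`; `V = diag(λ^{-1/2}) · Uᵀ`).
* `conj_graft_pencil` — congruence acts letterwise on a grafted pencil:
  `V̂ (∑ X^{dₗ} Sₗ + X^D P) V̂ᵀ = ∑ X^{dₗ} (V Sₗ Vᵀ) + X^D (V P Vᵀ)`, `V̂ = V.map C`.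
* `posDef_graft_congruence` — hence for `P ≻ 0` there are SYMMETRIC letters `S'ₗ = V Sₗ Vᵀ` on the SAME support with
  `roots (det (∑ X^{dₗ} Sₗ + X^D P)) = roots (det (∑ X^{dₗ} S'ₗ + X^D · 1))` as multisets (`det` scales by the nonzero
  constant `(det V)²`, `Polynomial.roots_C_mul`).
* `graftCount_posDef_le_of_one` — so at every `(m, K, D, d)` a bound on the positive-root count of identity grafts over all
  symmetric letters on `d` is the same bound for every positive definite far letter.
* `congruencePD` — **S4a VERBATIM**: the line's `TowerGraftLawId → TowerGraftLawPD` with the line defs `TowerGraftLawId`,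
  `TowerGraftLawPD`, `IsTower` inlined (the tree's `PosRootLawOn` is imported, as in the line file); same constant `C`.
  The line discharges the stub by `exact` (definitional unfolding).

Def-free; Mathlib + the census vocabulary file.  HONEST FRAMING: an elementary congruence normalisation inside a skeleton
for a RESTRICTED sub-case (`TowerWeakLifting`) of the crux — it moves the research rung S4 (`TowerGraftLawId`, OPEN,
not claimed) to the whole positive-definite far-letter case and nothing more; the record staircase (indefinite far
letter) is not covered; nothing here bears on `WeakLifting` itself, on Conjecture B / `KPlusLogSqLaw`, on
`MatrixDescartes` (18050) or on `VP ≠ VNP`.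
Seat: prover val-sym-lift-p3 g16, `--supports stmt-ValiantsHypothesis-19561`.
-/

-- `Summit.ValiantsHypothesis.ValiantsHypothesis.…` repeats a component by the D-0017 layout
-- (single-conjunct summit), which the `dupNamespace` linter flags; the name is mandated.
set_option linter.dupNamespace false

namespace Summit.ValiantsHypothesis.ValiantsHypothesis.Theorems.KPlusLogSqLaw.TowerGraft

open Finset Polynomial Matrix
open scoped BigOperators Polynomial
open Summit.ValiantsHypothesis.ValiantsHypothesis.Theorems.LacunarySymmetroidMatrixDescartes (PosRootLawOn)

/-- Over `ℝ`, a positive definite matrix is CONGRUENT TO THE IDENTITY: `V * P * Vᵀ = 1` for some `V` with `det V ≠ 0`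
(spectral theorem; `V = diag(λ^{-1/2}) · Uᵀ`). [folklore] -/
theorem exists_conj_eq_one {m : ℕ} {P : Matrix (Fin m) (Fin m) ℝ} (hP : P.PosDef) :
    ∃ V : Matrix (Fin m) (Fin m) ℝ, V.det ≠ 0 ∧ V * P * Vᵀ = 1 := by
  classical
  set U : Matrix (Fin m) (Fin m) ℝ := (hP.1.eigenvectorUnitary : Matrix (Fin m) (Fin m) ℝ) with hU
  have hdiag : star U * P * U = Matrix.diagonal hP.1.eigenvalues := by
    have h := hP.1.conjStarAlgAut_star_eigenvectorUnitary
    rw [Unitary.conjStarAlgAut_star_apply] at h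
    simpa [hU, RCLike.ofReal_real_eq_id] using h
  have hWU : star U * U = 1 := by
    exact Unitary.coe_star_mul_self hP.1.eigenvectorUnitary
  set c : Fin m → ℝ := fun i => (Real.sqrt (hP.1.eigenvalues i))⁻¹ with hc
  refine ⟨Matrix.diagonal c * star U, ?_, ?_⟩
  · have h1 : (star U).det * U.det = 1 := by rw [← Matrix.det_mul, hWU, Matrix.det_one]
    have hc0 : ∀ i, c i ≠ 0 := fun i => inv_ne_zero (Real.sqrt_pos.2 (hP.eigenvalues_pos i)).ne'
    rw [Matrix.det_mul, Matrix.det_diagonal]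
    exact mul_ne_zero (Finset.prod_ne_zero_iff.2 fun i _ => hc0 i) (left_ne_zero_of_mul_eq_one h1)
  · have hT : (star U)ᵀ = U := by
      ext i j
      simp [Matrix.star_eq_conjTranspose]
    rw [Matrix.transpose_mul, Matrix.diagonal_transpose, hT]
    calc Matrix.diagonal c * star U * P * (U * Matrix.diagonal c)
        = Matrix.diagonal c * (star U * P * U) * Matrix.diagonal c := by simp only [Matrix.mul_assoc]
      _ = Matrix.diagonal c * Matrix.diagonal hP.1.eigenvalues * Matrix.diagonal c := by rw [hdiag]
      _ = 1 := by
        rw [Matrix.diagonal_mul_diagonal, Matrix.diagonal_mul_diagonal, ← Matrix.diagonal_one]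
        congr 1
        funext i
        have hl : 0 < hP.1.eigenvalues i := hP.eigenvalues_pos i
        have hs : Real.sqrt (hP.1.eigenvalues i) ≠ 0 := (Real.sqrt_pos.2 hl).ne'
        simp only [hc]
        field_simp
        rw [Real.sq_sqrt hl.le]

/-- Congruence acts letterwise on a grafted pencil: with `V̂ = V.map C`,
`V̂ · (∑ₗ X^{dₗ} • Sₗ + X^D • P) · V̂ᵀ = ∑ₗ X^{dₗ} • (V Sₗ Vᵀ) + X^D • (V P Vᵀ)` (all matrices mapped by `C`). [folklore] -/
theorem conj_graft_pencil {m K : ℕ} (V : Matrix (Fin m) (Fin m) ℝ) (d : Fin K → ℕ) (D : ℕ)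
    (S : Fin K → Matrix (Fin m) (Fin m) ℝ) (P : Matrix (Fin m) (Fin m) ℝ) :
    V.map Polynomial.C * ((∑ l, ((X : ℝ[X]) ^ d l) • (S l).map Polynomial.C) + (X : ℝ[X]) ^ D • P.map Polynomial.C) *
        (V.map Polynomial.C)ᵀ
      = (∑ l, ((X : ℝ[X]) ^ d l) • (V * S l * Vᵀ).map Polynomial.C) +
          (X : ℝ[X]) ^ D • (V * P * Vᵀ).map Polynomial.C := by
  simp only [Matrix.mul_add, Matrix.add_mul, Finset.mul_sum, Finset.sum_mul, Matrix.mul_smul, Matrix.smul_mul,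
    Matrix.map_mul, Matrix.transpose_map]

/-- **Support-level congruence reduction (positive definite far letter ↦ identity far letter).**  For `P ≻ 0` there
are SYMMETRIC letters `S'ₗ = V Sₗ Vᵀ` on the SAME support `d` such that `det (∑ₗ X^{dₗ} Sₗ + X^D P)` and
`det (∑ₗ X^{dₗ} S'ₗ + X^D · 1)` have the same roots as multisets (they differ by the constant factor `(det V)² ≠ 0`).
[folklore] -/
theorem posDef_graft_congruence {m K : ℕ} (d : Fin K → ℕ) (D : ℕ) (S : Fin K → Matrix (Fin m) (Fin m) ℝ)
    (hS : ∀ l, (S l).IsSymm) (P : Matrix (Fin m) (Fin m) ℝ) (hP : P.PosDef) :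
    ∃ S' : Fin K → Matrix (Fin m) (Fin m) ℝ, (∀ l, (S' l).IsSymm) ∧
      (Matrix.det ((∑ l, ((X : ℝ[X]) ^ d l) • (S l).map Polynomial.C) + (X : ℝ[X]) ^ D • P.map Polynomial.C)).roots =
      (Matrix.det ((∑ l, ((X : ℝ[X]) ^ d l) • (S' l).map Polynomial.C) +
        (X : ℝ[X]) ^ D • (1 : Matrix (Fin m) (Fin m) ℝ[X]))).roots := by
  obtain ⟨V, hV, hVP⟩ := exists_conj_eq_one hP
  refine ⟨fun l => V * S l * Vᵀ, fun l => ?_, ?_⟩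
  · show (V * S l * Vᵀ)ᵀ = V * S l * Vᵀ
    rw [Matrix.transpose_mul, Matrix.transpose_mul, Matrix.transpose_transpose, (hS l).eq, Matrix.mul_assoc]
  · have h := congrArg Matrix.det (conj_graft_pencil V d D S P)
    rw [hVP, Matrix.map_one Polynomial.C (map_zero _) (map_one _), Matrix.det_mul, Matrix.det_mul,
      Matrix.det_transpose] at h
    have hdet : (V.map Polynomial.C).det = Polynomial.C V.det := by
      rw [RingHom.map_det, RingHom.mapMatrix_apply]
    rw [hdet] at h
    rw [← h, mul_comm (Polynomial.C V.det) _, mul_assoc, ← Polynomial.C_mul, mul_comm,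
      Polynomial.roots_C_mul _ (mul_ne_zero hV hV)]

/-- **Identity bound ⇒ positive definite bound, at every fixed `(m, K, D, d)`.**  If every identity graft `∑ₗ X^{dₗ} S'ₗ + X^D·1`
over symmetric letters on the support `d` has at most `N` distinct positive roots of its determinant, then so does every
graft `∑ₗ X^{dₗ} Sₗ + X^D P` of a positive definite far letter `P` over symmetric letters on `d`. [folklore] -/
theorem graftCount_posDef_le_of_one {m K : ℕ} (d : Fin K → ℕ) (D N : ℕ)
    (hId : ∀ (S' : Fin K → Matrix (Fin m) (Fin m) ℝ), (∀ l, (S' l).IsSymm) →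
      ((Matrix.det ((∑ l, ((X : ℝ[X]) ^ d l) • (S' l).map Polynomial.C) +
          (X : ℝ[X]) ^ D • (1 : Matrix (Fin m) (Fin m) ℝ[X]))).roots.toFinset.filter
        (fun t => 0 < t)).card ≤ N)
    (S : Fin K → Matrix (Fin m) (Fin m) ℝ) (hS : ∀ l, (S l).IsSymm) (P : Matrix (Fin m) (Fin m) ℝ)
    (hP : P.PosDef) :
    ((Matrix.det ((∑ l, ((X : ℝ[X]) ^ d l) • (S l).map Polynomial.C) +
        (X : ℝ[X]) ^ D • P.map Polynomial.C)).roots.toFinset.filter (fun t => 0 < t)).card ≤ N := by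
  obtain ⟨S', hS', hroots⟩ := posDef_graft_congruence d D S hS P hP
  rw [hroots]
  exact hId S' hS'

/-- **S4a `stub_congruencePD` (the line's `TowerGraftLawId → TowerGraftLawPD`, verbatim with the line defs
`TowerGraftLawId`, `TowerGraftLawPD`, `IsTower` inlined).**  The identity graft law on towers gives the graft law for
every positive DEFINITE far letter with the same constant `C`: the tower hypothesis, the gap `m·dₗ < D` and the budget
`PosRootLawOn m K B d` are passed through unchanged, and the count is transported by `graftCount_posDef_le_of_one`.
[this work] -/
theorem congruencePD :
    (∃ C : ℕ, ∀ (m K B D : ℕ) (d : Fin K → ℕ), (∀ l l' : Fin K, l < l' → m * d l < d l') → (∀ l, m * d l < D) →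
      PosRootLawOn m K B d →
        ∀ (S : Fin K → Matrix (Fin m) (Fin m) ℝ), (∀ l, (S l).IsSymm) →
          ((Matrix.det ((∑ l, ((X : ℝ[X]) ^ d l) • (S l).map Polynomial.C) +
              (X : ℝ[X]) ^ D • (1 : Matrix (Fin m) (Fin m) ℝ[X]))).roots.toFinset.filter
            (fun t => 0 < t)).card ≤ 2 ^ C * B + 2 ^ (C * Nat.log 2 m ^ 2)) →
    (∃ C : ℕ, ∀ (m K B D : ℕ) (d : Fin K → ℕ), (∀ l l' : Fin K, l < l' → m * d l < d l') → (∀ l, m * d l < D) →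
      PosRootLawOn m K B d →
        ∀ (S : Fin K → Matrix (Fin m) (Fin m) ℝ) (P : Matrix (Fin m) (Fin m) ℝ), (∀ l, (S l).IsSymm) → P.PosDef →
          ((Matrix.det ((∑ l, ((X : ℝ[X]) ^ d l) • (S l).map Polynomial.C) +
              (X : ℝ[X]) ^ D • P.map Polynomial.C)).roots.toFinset.filter
            (fun t => 0 < t)).card ≤ 2 ^ C * B + 2 ^ (C * Nat.log 2 m ^ 2)) := by
  rintro ⟨C, hC⟩
  refine ⟨C, fun m K B D d hd hD hB S P hS hP => ?_⟩
  exact graftCount_posDef_le_of_one d D _ (fun S' hS' => hC m K B D d hd hD hB S' hS') S hS P hP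

end Summit.ValiantsHypothesis.ValiantsHypothesis.Theorems.KPlusLogSqLaw.TowerGraft
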